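import Summits.CriticalPhenomena.Ising3DConformalLimit.Theses.PerfectScreening
import Summits.CriticalPhenomena.Ising3DConformalLimit.Theses.EnergyNotSigmaSquared
import Summits.CriticalPhenomena.Ising3DConformalLimit.Theses.AnomalousForcesInteraction
import Summits.CriticalPhenomena.Ising3DConformalLimit.Theses.GammaForcesInteraction
import Summits.CriticalPhenomena.Ising3DConformalLimit.Theses.BernsteinTemperature
import Summits.CriticalPhenomena.Ising3DConformalLimit.Theses.PrecisionLaplacian
import Summits.CriticalPhenomena.Ising3DConformalLimit.Theses.HyperoctahedralRP
import Summits.CriticalPhenomena.Ising3DConformalLimit.Theorems.HyperoctahedralRPHRP2Rigidity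
import Summits.CriticalPhenomena.Ising3DConformalLimit.Theorems.MoebiusLimitExists.Negative.PinnedClusterPoints
import Summits.CriticalPhenomena.Ising3DConformalLimit.Theorems.MoebiusLimitExists.Negative.DeltaUnique
import Summits.CriticalPhenomena.Ising3DConformalLimit.Theorems.MoebiusLimitExists.Negative.ScaleRedundant
import HarnessLib

/-!
# The crux `MoebiusLimitExists` IS the conjunction of the three cruxes of route `HyperoctahedralRP`
(crux item stmt-CriticalPhenomena-1344, line `only-interaction-breaks-moebius`, lead c4, 2026-08-16;
`--supports stmt-CriticalPhenomena-1344`)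

An exact factorisation of the crux `MoebiusLimitExists` (= `EnergyNotSigmaSquared.MoebiusLimit`, shared by
eleven routes: "the critical Ising correlators on `ℤ³` have a non-degenerate pointwise scaling limit which is
Möbius covariant") through three EXISTING crux items of route `HyperoctahedralRP`:

* item stmt-CriticalPhenomena-1981 `ExistsScaleCovariantLimit` — a normalised, non-degenerate, translation
  invariant, scale covariant pointwise limit exists;
* item stmt-CriticalPhenomena-1980 `LimitRotationInvariant` — (given `HRP2Rigidity`, item 1979, which is the
  tree theorem `HRP2Rigidity_of`) every such limit is `O(3)` invariant;
* item stmt-CriticalPhenomena-1982 `InversionUpgradeNormalised` — every normalised, non-degenerate, Euclidean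
  invariant, scale covariant limit is inversion covariant.

Main results:

* `MoebiusLimitExists_of_hrp : 1981 → 1980 → 1982 → MoebiusLimitExists` (assembly, no other input);
* `existsScaleCovariantLimit_of_MoebiusLimitExists`, `limitRotationInvariant_of_MoebiusLimitExists`,
  `inversionUpgradeNormalised_of_MoebiusLimitExists` — the crux implies EACH of the three items (the two
  `∀`-items included: any two non-degenerate pointwise limits of the critical correlators are proportional
  order by order off the diagonals, `exists_ratio_of_two_limits`, so covariance transfers from the crux
  witness to every limit);
* `MoebiusLimitExists_iff_hrp : MoebiusLimitExists ↔ 1981 ∧ 1980 ∧ 1982` — so crux 1344 is EXACTLY as hard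
  as the three `HyperoctahedralRP` cruxes together, each of which is necessary; the same for the sibling
  spellings `EnergyNotSigmaSquared.MoebiusLimit`, `AnomalousForcesInteraction.MoebiusLimit`,
  `GammaForcesInteraction.MoebiusLimit`, and the assembly for crux stmt-4801 `MoebiusLimitOfTwoPointLaw`
  (`BernsteinTemperature` / `PrecisionLaplacian`).

For the planners: crux 1344 (and 4801) can be re-lined as the pure ASSEMBLY of items 1981, 1980, 1982; the
line `only-interaction-breaks-moebius` adds, under item 0634, the finer information that 1981 is equivalent
to its uniqueness residue 6′ and that compactness / the free branch are theorems
(`…ResidueDictionary.lean`, `…ReductionCpt.lean`).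

References: H. Duminil-Copin, *100 years of the (critical) Ising model on the hypercubic lattice*, ICM 2022,
§8.1 p. 25 and §8.4 p. 29 (existence, rotations, conformal invariance: all open on `ℤ³`); A. M. Polyakov,
JETP Lett. 12 (1970) 381 (the inversion upgrade); P. Di Francesco, P. Mathieu, D. Sénéchal, *Conformal Field
Theory* (1997) §4.3.1 (Möbius covariance = Euclid + dilations + inversion). No definitions, no `sorry`.
-/

noncomputable section

open Filter Topology Set Function
open Literature.Probability.LatticeModels
open Summit.CriticalPhenomena.Ising3DConformalLimit.Theses

namespace Summit.CriticalPhenomena.Ising3DConformalLimit.MoebiusLimitExistsOnlyInteraction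

open Summit.CriticalPhenomena.Ising3DConformalLimit.MoebiusLimitExistsNegative
open Summit.CriticalPhenomena.Ising3DConformalLimit.PinnedClusterPoints

/-! ### Two limits are proportional -/

/-- **Any two non-degenerate pointwise scaling limits of the critical `ℤ³` correlators are proportional,
order by order, off the diagonals**: `S₂ₙ = κⁿ S₁ₙ` on `NonCoincident 3 n` with one `κ > 0` (both are
multiples of the pointwise limit of the PINNED zoom, `PinnedClusterPoints.tendsto_rescaled_pin`). [folklore] -/
theorem exists_ratio_of_two_limits {ρ₁ ρ₂ : ℝ → ℝ} {S₁ S₂ : CorrFamily 3}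
    (hρ₁ : ∀ δ ∈ Set.Ioc (0:ℝ) 1, 0 < ρ₁ δ) (hlim₁ : HasPointwiseScalingLimit (criticalCorr 3) ρ₁ S₁)
    (hnd₁ : IsNondegenerateTwoPoint S₁)
    (hρ₂ : ∀ δ ∈ Set.Ioc (0:ℝ) 1, 0 < ρ₂ δ) (hlim₂ : HasPointwiseScalingLimit (criticalCorr 3) ρ₂ S₂)
    (hnd₂ : IsNondegenerateTwoPoint S₂) :
    ∃ κ : ℝ, 0 < κ ∧ ∀ n, ∀ x ∈ NonCoincident 3 n, S₂ n x = κ ^ n * S₁ n x := by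
  have ha₁ : 0 < (S₁ 2 (![0, EuclideanSpace.single 0 1] : Fin 2 → EuclideanSpace ℝ (Fin 3))) ^ (-(1 / 2 : ℝ)) :=
    Real.rpow_pos_of_pos (hnd₁ _ cfg01_mem) _
  have ha₂ : 0 < (S₂ 2 (![0, EuclideanSpace.single 0 1] : Fin 2 → EuclideanSpace ℝ (Fin 3))) ^ (-(1 / 2 : ℝ)) :=
    Real.rpow_pos_of_pos (hnd₂ _ cfg01_mem) _
  refine ⟨(S₁ 2 (![0, EuclideanSpace.single 0 1] : Fin 2 → EuclideanSpace ℝ (Fin 3))) ^ (-(1 / 2 : ℝ)) /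
      (S₂ 2 (![0, EuclideanSpace.single 0 1] : Fin 2 → EuclideanSpace ℝ (Fin 3))) ^ (-(1 / 2 : ℝ)),
    div_pos ha₁ ha₂, fun n x hx => ?_⟩
  have heq := tendsto_nhds_unique (tendsto_rescaled_pin hρ₁ hlim₁ hnd₁ hx)
    (tendsto_rescaled_pin hρ₂ hlim₂ hnd₂ hx)
  rw [div_pow, div_mul_eq_mul_div, eq_div_iff (pow_ne_zero _ ha₂.ne'), heq, mul_comm]

/-! ### The assembly `1981 ∧ 1980 ∧ 1982 ⇒ crux` -/

/-- **ASSEMBLY: items 1981, 1980, 1982 of route `HyperoctahedralRP` give the crux `MoebiusLimitExists`.**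
The witness of 1981 is rotation invariant by 1980 (its hypothesis `HRP2Rigidity`, item 1979, is the tree
theorem `HRP2Rigidity_of`), hence Euclidean invariant, hence inversion covariant by 1982; Möbius covariance is
the conjunction. [cite: FrancescoMathieuSenechal1997, §4.3.1 eq. (4.62)] -/
theorem MoebiusLimitExists_of_hrp
    (h1981 : HyperoctahedralRP.ExistsScaleCovariantLimit)
    (h1980 : HyperoctahedralRP.LimitRotationInvariant)
    (h1982 : HyperoctahedralRP.InversionUpgradeNormalised) :
    PerfectScreening.MoebiusLimitExists := by
  obtain ⟨ρ, Δ, S, hρ, hΔ, hlim, hnorm, hnd, htr, hsc⟩ := h1981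
  have hrot : IsRotationInvariant S :=
    h1980 _root_.Summit.CriticalPhenomena.Ising3DConformalLimit.Cruxes.HRP2Rigidity.XRayMellin.HRP2Rigidity_of
      ρ Δ S hρ hlim hnorm hnd htr hsc
  have hinv : IsInversionCovariant Δ S := h1982 ρ Δ S hρ hlim hnorm hnd ⟨htr, hrot⟩ hsc
  exact ⟨ρ, Δ, S, hρ, hΔ, hlim, hnd, ⟨htr, hrot⟩, hsc, hinv⟩

/-! ### The crux implies each of the three items -/

open Classical in
/-- **crux ⇒ item 1981**: normalise the Möbius witness off the diagonals (limit, non-degeneracy,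
translations and dilations survive normalisation). [folklore] -/
theorem existsScaleCovariantLimit_of_MoebiusLimitExists (h : PerfectScreening.MoebiusLimitExists) :
    HyperoctahedralRP.ExistsScaleCovariantLimit := by
  obtain ⟨ρ, Δ, S, hρ, hΔ, hlim, hnd, hM⟩ := h
  refine ⟨ρ, Δ, fun n x => if x ∈ NonCoincident 3 n then S n x else 0, hρ, hΔ, normalised_hasLimit hlim,
    fun n z hz => ?_, normalised_nondeg hnd, normalised_translation hM.1.1, normalised_scale hM.2.1⟩
  exact if_neg hz

/-- **crux ⇒ item 1980** (indeed its conclusion, for every limit, with no use of `HRP2Rigidity`): any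
normalised non-degenerate pointwise limit is proportional order by order to the Möbius witness
(`exists_ratio_of_two_limits`), so it inherits `O(3)` invariance on `NonCoincident`, and vanishes with its
rotate off it. [folklore] -/
theorem limitRotationInvariant_of_MoebiusLimitExists (h : PerfectScreening.MoebiusLimitExists) :
    HyperoctahedralRP.LimitRotationInvariant := by
  intro _ ρ Δ S hρ hlim hnorm hnd _ _ n R x
  obtain ⟨ρ₀, Δ₀, S₀, hρ₀, -, hlim₀, hnd₀, hM₀⟩ := h
  obtain ⟨κ, -, hprop⟩ := exists_ratio_of_two_limits hρ₀ hlim₀ hnd₀ hρ hlim hnd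
  have hiff : (fun i => R (x i)) ∈ NonCoincident 3 n ↔ x ∈ NonCoincident 3 n := by
    rw [mem_nonCoincident, mem_nonCoincident]
    exact R.injective.of_comp_iff x
  by_cases hx : x ∈ NonCoincident 3 n
  · rw [hprop n _ (hiff.2 hx), hprop n x hx, hM₀.1.2 n R x]
  · rw [hnorm n _ (mt hiff.1 hx), hnorm n x hx]

/-- **crux ⇒ item 1982**: a normalised non-degenerate Euclidean-invariant scale-covariant limit has the
witness's dimension (`DeltaUnique.delta_unique_of_covariantLimits`) and is proportional to the witness order
by order (`exists_ratio_of_two_limits`), so it inherits inversion covariance on `NonCoincident` (the factor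
`κⁿ` cancels) and vanishes with its inverse image off it. [cite: FrancescoMathieuSenechal1997, §4.3.1 eq. (4.56)] -/
theorem inversionUpgradeNormalised_of_MoebiusLimitExists (h : PerfectScreening.MoebiusLimitExists) :
    HyperoctahedralRP.InversionUpgradeNormalised := by
  intro ρ Δ S hρ hlim hnorm hnd hE hsc n x hx0
  obtain ⟨ρ₀, Δ₀, S₀, hρ₀, -, hlim₀, hnd₀, hM₀⟩ := h
  have hΔ : Δ = Δ₀ :=
    delta_unique_of_covariantLimits hρ hlim hnd hE.2 hsc hρ₀ hlim₀ hnd₀ hM₀.1.2 hM₀.2.1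
  obtain ⟨κ, -, hprop⟩ := exists_ratio_of_two_limits hρ₀ hlim₀ hnd₀ hρ hlim hnd
  have hiff : (fun i => EuclideanGeometry.inversion (0 : EuclideanSpace ℝ (Fin 3)) 1 (x i)) ∈
      NonCoincident 3 n ↔ x ∈ NonCoincident 3 n := by
    rw [mem_nonCoincident, mem_nonCoincident]
    exact (EuclideanGeometry.inversion_injective _ one_ne_zero).of_comp_iff x
  by_cases hx : x ∈ NonCoincident 3 n
  · rw [hprop n _ (hiff.2 hx), hprop n x hx, hM₀.2.2 n x hx0, hΔ]
    ring
  · rw [hnorm n _ (mt hiff.1 hx), hnorm n x hx, mul_zero]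

/-! ### The factorisation -/

/-- **`MoebiusLimitExists ⟺ 1981 ∧ 1980 ∧ 1982`** — crux stmt-1344 is EXACTLY the conjunction of the three
cruxes `ExistsScaleCovariantLimit`, `LimitRotationInvariant`, `InversionUpgradeNormalised` of route
`HyperoctahedralRP`; each is necessary and together they are sufficient. [cite: DuminilCopinICM2022, §8.1 p. 25 and §8.4 p. 29] -/
theorem MoebiusLimitExists_iff_hrp :
    Summit.CriticalPhenomena.Ising3DConformalLimit.Theses.PerfectScreening.MoebiusLimitExists ↔
      Summit.CriticalPhenomena.Ising3DConformalLimit.Theses.HyperoctahedralRP.ExistsScaleCovariantLimit ∧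
        Summit.CriticalPhenomena.Ising3DConformalLimit.Theses.HyperoctahedralRP.LimitRotationInvariant ∧
          Summit.CriticalPhenomena.Ising3DConformalLimit.Theses.HyperoctahedralRP.InversionUpgradeNormalised :=
  ⟨fun h => ⟨existsScaleCovariantLimit_of_MoebiusLimitExists h,
      limitRotationInvariant_of_MoebiusLimitExists h, inversionUpgradeNormalised_of_MoebiusLimitExists h⟩,
    fun h => MoebiusLimitExists_of_hrp h.1 h.2.1 h.2.2⟩

/-- The factorisation for the host-route spelling `EnergyNotSigmaSquared.MoebiusLimit` (the same term;
item stmt-CriticalPhenomena-1344). [cite: DuminilCopinICM2022, §8.4 p. 29] -/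
theorem MoebiusLimit_iff_hrp :
    EnergyNotSigmaSquared.MoebiusLimit ↔
      HyperoctahedralRP.ExistsScaleCovariantLimit ∧ HyperoctahedralRP.LimitRotationInvariant ∧
        HyperoctahedralRP.InversionUpgradeNormalised :=
  MoebiusLimitExists_iff_hrp

/-- The factorisation for the spelling `AnomalousForcesInteraction.MoebiusLimit` (item stmt-1344).
[cite: DuminilCopinICM2022, §8.4 p. 29] -/
theorem anomalousForces_MoebiusLimit_iff_hrp :
    AnomalousForcesInteraction.MoebiusLimit ↔
      HyperoctahedralRP.ExistsScaleCovariantLimit ∧ HyperoctahedralRP.LimitRotationInvariant ∧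
        HyperoctahedralRP.InversionUpgradeNormalised :=
  MoebiusLimitExists_iff_hrp

/-- The factorisation for the spelling `GammaForcesInteraction.MoebiusLimit` (item stmt-1344).
[cite: DuminilCopinICM2022, §8.4 p. 29] -/
theorem gammaForces_MoebiusLimit_iff_hrp :
    GammaForcesInteraction.MoebiusLimit ↔
      HyperoctahedralRP.ExistsScaleCovariantLimit ∧ HyperoctahedralRP.LimitRotationInvariant ∧
        HyperoctahedralRP.InversionUpgradeNormalised :=
  MoebiusLimitExists_iff_hrp

/-- **ASSEMBLY for crux stmt-4801 `MoebiusLimitOfTwoPointLaw`** (`BernsteinTemperature` spelling: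
item 0634 → crux 1344): items 1981, 1980, 1982 give it outright, the two-point-law hypothesis unused.
[cite: DuminilCopinICM2022, §8.4 p. 29] -/
theorem MoebiusLimitOfTwoPointLaw_of_hrp
    (h1981 : HyperoctahedralRP.ExistsScaleCovariantLimit)
    (h1980 : HyperoctahedralRP.LimitRotationInvariant)
    (h1982 : HyperoctahedralRP.InversionUpgradeNormalised) :
    BernsteinTemperature.MoebiusLimitOfTwoPointLaw :=
  fun _ => MoebiusLimitExists_of_hrp h1981 h1980 h1982

/-- The same assembly for the `PrecisionLaplacian` spelling of crux stmt-4801. [cite: DuminilCopinICM2022, §8.4 p. 29] -/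
theorem precisionLaplacian_MoebiusLimitOfTwoPointLaw_of_hrp
    (h1981 : HyperoctahedralRP.ExistsScaleCovariantLimit)
    (h1980 : HyperoctahedralRP.LimitRotationInvariant)
    (h1982 : HyperoctahedralRP.InversionUpgradeNormalised) :
    PrecisionLaplacian.MoebiusLimitOfTwoPointLaw :=
  fun _ => MoebiusLimitExists_of_hrp h1981 h1980 h1982

end Summit.CriticalPhenomena.Ising3DConformalLimit.MoebiusLimitExistsOnlyInteraction

end
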